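import Literature.MathematicalPhysics.QuantumFieldTheory.BalabanImbrieJaffe1984to88.BIJ88DirichletForms305

/-!
# `BalabanImbrieJaffe1984to88.BIJ88DirichletDeriv305` — T. Bałaban, J. Imbrie, A. Jaffe, *Effective action and cluster
properties of the abelian Higgs model*, Commun. Math. Phys. **114** (1988) 257–315 [BalabanImbrieJaffe1988], §5.13 p. 305: the
`s`-DERIVATIVES of the interpolated form `Δ_s` — *"the first derivative produces a term Σ_{j≠i} s_j⟨□_iΦ, Δ□_jΦ⟩"* — PROVED
at the level of the quadratic form `⟨Φ, Δ_sΦ⟩` (companion of `BIJ88DirichletForms305`)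

statement-level skeleton of published theorems with citation tags; proofs where landed; nothing here is a claim about the Yang–Mills mass gap

PDF held: `paper:balaban1988-cmp114-bij-abelian-higgs-effective-action` (journal page = PDF page + 256).  Render read this
session: p. 305 = PDF 49 (`pages/original-p049-x2.png` of the p02 seat, read as image).

**What the paper prints (p. 305, verbatim).**  After the block identities *"□_iΔ_s□_{i′} = s_is_{i′}□_iΔ□_{i′}, i′ ≠ i, □_iΔ_s□_i =
□_iΔ□_i"* and the FTC expansion: *"To calculate the s-derivatives, note that the first derivative produces a term
⟨Σ_{j≠i} s_j⟨□_iΦ, Δ□_jΦ⟩; Π_{i∈I} f(□_i)⟩_{s_Γ}. Subsequent derivatives either hit factors s_j already pulled down or bring new terms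
down with new truncations."*

**What is reproduced here (kernel-checked, zero `sorry`, no named facts).**  In the setting of `BIJ88DirichletForms305` (block map
`blk : α → I`, `Δ_s = interpForm blk Δ s`):
* DEFINITIONS: **`blockPair blk Δ Φ i j`** `= ⟨□_iΦ, Δ□_jΦ⟩` (the printed pairing), **`dInterpForm blk Δ s i`** (the matrix
  `∂Δ_s/∂s_i`, body: the entry formula read off the block identities).
* **`interpForm_update`** — `Δ_s` is AFFINE in each `s_i`: `Δ_{s[i↦t]} = Δ_{s[i↦0]} + t·∂Δ_s/∂s_i`;
  **`dInterpForm_eq_sum`** — `∂Δ_s/∂s_i = Σ_{j≠i} s_j(□_iΔ□_j + □_jΔ□_i)` (from the block identities).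
* **`quadForm_interpForm_update`** — `⟨Φ, Δ_{s[i↦t]}Φ⟩ = ⟨Φ, Δ_{s[i↦0]}Φ⟩ + t·Σ_{j≠i} s_j(⟨□_iΦ, Δ□_jΦ⟩ + ⟨□_jΦ, Δ□_iΦ⟩)`;
  **`hasDerivAt_quadForm_interpForm`** — `∂/∂s_i ⟨Φ, Δ_sΦ⟩ = Σ_{j≠i} s_j(⟨□_iΦ, Δ□_jΦ⟩ + ⟨□_jΦ, Δ□_iΦ⟩)`, and for symmetric `Δ`
  **`hasDerivAt_half_quadForm_interpForm`** — `∂/∂s_i ½⟨Φ, Δ_sΦ⟩ = Σ_{j≠i} s_j⟨□_iΦ, Δ□_jΦ⟩`, THE PRINTED TERM (the factor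
  pulled down by `∂/∂s_i` from a Gaussian weight `exp(±½⟨Φ, Δ_sΦ⟩)`).

**Readings (declared).**  (i) the statement is about the quadratic form; that differentiating the Gaussian EXPECTATION `⟨·⟩_s`
produces the truncated expectation `⟨A; B⟩` of this term is the standard Gaussian calculus and is not modelled here; (ii) real
fields, `Δ` any real matrix (symmetric for the halved form).

**What is NOT claimed.**  The pairing/walk expansion (5.13.3), integration by parts *"(see Eqs. (12.2), (12.3) of [3])"*, truncated
expectations; anything of B1–B16.  NOT summit progress; NOT continuum; NOT Clay.  Imports: `BIJ88DirichletForms305` (p02, p252603);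
no Summits import; sub-namespace `…BIJ88DirichletDeriv305`; modifies nothing.  Cell `lit-balaban` Phase 2, seat p02 gen 4; row
C2.Eq5.13.3-5.13.4 (owner r16), p. 305 «the first derivative produces a term Σ_{j≠i}s_j⟨□_iΦ,Δ□_jΦ⟩» → proved (form level).
-/

open scoped BigOperators Matrix
open Finset Function

namespace Literature.MathematicalPhysics.QuantumFieldTheory.BalabanImbrieJaffe1984to88.BIJ88DirichletDeriv305

open BIJ88DirichletForms305 (boxProj interpForm interpForm_apply boxProj_mul_mul_boxProj_apply boxProj_mulVec_apply)

variable {α I : Type*} [Fintype α] [DecidableEq α] [Fintype I] [DecidableEq I] (blk : α → I)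

/-- **`⟨□_iΦ, Δ□_jΦ⟩`** — the pairing printed on p. 305. [cite: BalabanImbrieJaffe1988, (5.13.3) p.305] -/
def blockPair (Δ : Matrix α α ℝ) (Φ : α → ℝ) (i j : I) : ℝ :=
  (boxProj blk i *ᵥ Φ) ⬝ᵥ (Δ *ᵥ (boxProj blk j *ᵥ Φ))

/-- **`∂Δ_s/∂s_i`** as a matrix: by the block identities of p. 305 the entry `(x,y)` of `Δ_s` is `s_{□(x)}s_{□(y)}Δ_{xy}` off the
block diagonal and `Δ_{xy}` on it, so its `s_i`-derivative is `([□(x)=i]s_{□(y)} + [□(y)=i]s_{□(x)})Δ_{xy}` off the diagonal, `0` on it.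
[cite: BalabanImbrieJaffe1988, (5.13.3) p.305] -/
def dInterpForm (Δ : Matrix α α ℝ) (s : I → ℝ) (i : I) : Matrix α α ℝ :=
  Matrix.of fun x y =>
    if blk x = blk y then 0 else ((if blk x = i then s (blk y) else 0) + (if blk y = i then s (blk x) else 0)) * Δ x y

/-- `Δ_s` is affine in each parameter: `Δ_{s[i↦t]} = Δ_{s[i↦0]} + t·∂Δ_s/∂s_i`. [cite: BalabanImbrieJaffe1988, (5.13.3) p.305] -/
theorem interpForm_update (Δ : Matrix α α ℝ) (s : I → ℝ) (i : I) (t : ℝ) :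
    interpForm blk Δ (update s i t) = interpForm blk Δ (update s i 0) + t • dInterpForm blk Δ s i := by
  ext x y
  rw [Matrix.add_apply, Matrix.smul_apply, interpForm_apply, interpForm_apply, dInterpForm, Matrix.of_apply, smul_eq_mul]
  by_cases hxy : blk x = blk y
  · simp [hxy]
  · rw [if_neg hxy, if_neg hxy, if_neg hxy]
    by_cases hx : blk x = i
    · have hy : blk y ≠ i := fun h => hxy (hx.trans h.symm)
      rw [hx, update_self, update_self, update_of_ne hy, if_pos rfl, if_neg hy]
      ring
    · by_cases hy : blk y = i
      · rw [hy, update_self, update_self, update_of_ne hx, if_neg hx, if_pos rfl]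
        ring
      · rw [update_of_ne hx, update_of_ne hy, update_of_ne hx, update_of_ne hy, if_neg hx, if_neg hy]
        ring

/-- **`∂Δ_s/∂s_i = Σ_{j≠i} s_j(□_iΔ□_j + □_jΔ□_i)`** — the operator form read off the block identities.
[cite: BalabanImbrieJaffe1988, (5.13.3) p.305] -/
theorem dInterpForm_eq_sum (Δ : Matrix α α ℝ) (s : I → ℝ) (i : I) :
    dInterpForm blk Δ s i =
      ∑ j ∈ univ.erase i, s j • ((boxProj blk i * Δ * boxProj blk j : Matrix α α ℝ) + boxProj blk j * Δ * boxProj blk i) := by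
  ext x y
  rw [dInterpForm, Matrix.of_apply, Matrix.sum_apply]
  simp_rw [Matrix.smul_apply, Matrix.add_apply, boxProj_mul_mul_boxProj_apply, smul_eq_mul]
  by_cases hxy : blk x = blk y
  · -- on the block diagonal every summand vanishes (j ≠ i forces it)
    rw [if_pos hxy]
    symm
    refine Finset.sum_eq_zero fun j hj => ?_
    have hji : j ≠ i := (Finset.mem_erase.1 hj).1
    have h1 : ¬(blk x = i ∧ blk y = j) := fun h => hji (h.2.symm.trans (hxy.symm.trans h.1))
    have h2 : ¬(blk x = j ∧ blk y = i) := fun h => hji (h.1.symm.trans (hxy.trans h.2))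
    rw [if_neg h1, if_neg h2, add_zero, mul_zero]
  · rw [if_neg hxy]
    by_cases hx : blk x = i
    · have hy : blk y ≠ i := fun h => hxy (hx.trans h.symm)
      rw [if_pos hx, if_neg hy, add_zero]
      -- only j = blk y contributes, through the first summand
      rw [Finset.sum_eq_single (blk y)]
      · rw [if_pos ⟨hx, rfl⟩, if_neg (fun h => hy h.2), add_zero]
      · intro j _ hj
        have h1 : ¬(blk x = i ∧ blk y = j) := fun h => hj h.2.symm
        have h2 : ¬(blk x = j ∧ blk y = i) := fun h => hy h.2
        rw [if_neg h1, if_neg h2, add_zero, mul_zero]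
      · intro h
        exact absurd (Finset.mem_erase.2 ⟨hy, Finset.mem_univ _⟩) h
    · rw [if_neg hx, zero_add]
      by_cases hy : blk y = i
      · rw [if_pos hy]
        rw [Finset.sum_eq_single (blk x)]
        · rw [if_neg (fun h => hx h.1), if_pos ⟨rfl, hy⟩, zero_add]
        · intro j _ hj
          have h1 : ¬(blk x = i ∧ blk y = j) := fun h => hx h.1
          have h2 : ¬(blk x = j ∧ blk y = i) := fun h => hj h.1.symm
          rw [if_neg h1, if_neg h2, add_zero, mul_zero]
        · intro h
          exact absurd (Finset.mem_erase.2 ⟨hx, Finset.mem_univ _⟩) h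
      · rw [if_neg hy, zero_mul]
        symm
        refine Finset.sum_eq_zero fun j _ => ?_
        have h1 : ¬(blk x = i ∧ blk y = j) := fun h => hx h.1
        have h2 : ¬(blk x = j ∧ blk y = i) := fun h => hy h.2
        rw [if_neg h1, if_neg h2, add_zero, mul_zero]

omit [Fintype I] in
/-- the quadratic form of `□_iΔ□_j`: `⟨Φ, (□_iΔ□_j)Φ⟩ = ⟨□_iΦ, Δ□_jΦ⟩`. [cite: BalabanImbrieJaffe1988, (5.13.3) p.305] -/
theorem quadForm_boxSandwich (Δ : Matrix α α ℝ) (Φ : α → ℝ) (i j : I) :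
    Φ ⬝ᵥ ((boxProj blk i * Δ * boxProj blk j : Matrix α α ℝ) *ᵥ Φ) = blockPair blk Δ Φ i j := by
  have hP : ∀ (d : α → ℝ) (w : α → ℝ), w ᵥ* Matrix.diagonal d = Matrix.diagonal d *ᵥ w := fun d w => by
    ext x
    rw [Matrix.vecMul_diagonal, Matrix.mulVec_diagonal, mul_comm]
  rw [blockPair, ← Matrix.mulVec_mulVec, ← Matrix.mulVec_mulVec, Matrix.dotProduct_mulVec, boxProj, hP]

/-- **`⟨Φ, Δ_{s[i↦t]}Φ⟩ = ⟨Φ, Δ_{s[i↦0]}Φ⟩ + t·Σ_{j≠i} s_j(⟨□_iΦ, Δ□_jΦ⟩ + ⟨□_jΦ, Δ□_iΦ⟩)`** — the quadratic form is affine in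
`s_i` with the printed slope. [cite: BalabanImbrieJaffe1988, (5.13.3) p.305] -/
theorem quadForm_interpForm_update (Δ : Matrix α α ℝ) (s : I → ℝ) (i : I) (Φ : α → ℝ) (t : ℝ) :
    Φ ⬝ᵥ (interpForm blk Δ (update s i t) *ᵥ Φ) =
      Φ ⬝ᵥ (interpForm blk Δ (update s i 0) *ᵥ Φ) +
        t * ∑ j ∈ univ.erase i, s j * (blockPair blk Δ Φ i j + blockPair blk Δ Φ j i) := by
  rw [interpForm_update, dInterpForm_eq_sum, Matrix.add_mulVec, dotProduct_add, Matrix.smul_mulVec, dotProduct_smul,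
    smul_eq_mul, Matrix.sum_mulVec, dotProduct_sum]
  congr 2
  refine Finset.sum_congr rfl fun j _ => ?_
  rw [Matrix.smul_mulVec, dotProduct_smul, smul_eq_mul, Matrix.add_mulVec, dotProduct_add, quadForm_boxSandwich,
    quadForm_boxSandwich]

/-- **p. 305, the `s`-derivative**: `∂/∂s_i ⟨Φ, Δ_sΦ⟩ = Σ_{j≠i} s_j(⟨□_iΦ, Δ□_jΦ⟩ + ⟨□_jΦ, Δ□_iΦ⟩)` (at every value of `s_i`).
[cite: BalabanImbrieJaffe1988, (5.13.3) p.305] -/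
theorem hasDerivAt_quadForm_interpForm (Δ : Matrix α α ℝ) (s : I → ℝ) (i : I) (Φ : α → ℝ) (t : ℝ) :
    HasDerivAt (fun u => Φ ⬝ᵥ (interpForm blk Δ (update s i u) *ᵥ Φ))
      (∑ j ∈ univ.erase i, s j * (blockPair blk Δ Φ i j + blockPair blk Δ Φ j i)) t := by
  have h : (fun u => Φ ⬝ᵥ (interpForm blk Δ (update s i u) *ᵥ Φ)) = fun u =>
      Φ ⬝ᵥ (interpForm blk Δ (update s i 0) *ᵥ Φ) +
        u * ∑ j ∈ univ.erase i, s j * (blockPair blk Δ Φ i j + blockPair blk Δ Φ j i) := by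
    funext u
    exact quadForm_interpForm_update blk Δ s i Φ u
  rw [h]
  have hid := ((hasDerivAt_id t).mul_const (∑ j ∈ univ.erase i, s j * (blockPair blk Δ Φ i j + blockPair blk Δ Φ j i)))
  rw [one_mul] at hid
  exact hid.const_add _

omit [Fintype I] in
/-- for symmetric `Δ` the two pairings coincide: `⟨□_jΦ, Δ□_iΦ⟩ = ⟨□_iΦ, Δ□_jΦ⟩`. [cite: BalabanImbrieJaffe1988, (5.13.3) p.305] -/
theorem blockPair_comm {Δ : Matrix α α ℝ} (hΔ : Δ.IsSymm) (Φ : α → ℝ) (i j : I) :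
    blockPair blk Δ Φ j i = blockPair blk Δ Φ i j := by
  rw [blockPair, blockPair, Matrix.dotProduct_mulVec, ← Matrix.mulVec_transpose, hΔ.eq, dotProduct_comm]

/-- **p. 305, verbatim: *"the first derivative produces a term Σ_{j≠i} s_j⟨□_iΦ, Δ□_jΦ⟩"*** — PROVED at the level of the form:
for symmetric `Δ`, `∂/∂s_i (½⟨Φ, Δ_sΦ⟩) = Σ_{j≠i} s_j⟨□_iΦ, Δ□_jΦ⟩` (the factor differentiated out of a Gaussian weight
`exp(±½⟨Φ, Δ_sΦ⟩)`). [cite: BalabanImbrieJaffe1988, (5.13.3) p.305] -/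
theorem hasDerivAt_half_quadForm_interpForm {Δ : Matrix α α ℝ} (hΔ : Δ.IsSymm) (s : I → ℝ) (i : I) (Φ : α → ℝ) (t : ℝ) :
    HasDerivAt (fun u => (1 / 2 : ℝ) * (Φ ⬝ᵥ (interpForm blk Δ (update s i u) *ᵥ Φ)))
      (∑ j ∈ univ.erase i, s j * blockPair blk Δ Φ i j) t := by
  have h := (hasDerivAt_quadForm_interpForm blk Δ s i Φ t).const_mul (1 / 2 : ℝ)
  refine h.congr_deriv ?_
  rw [Finset.mul_sum]
  refine Finset.sum_congr rfl fun j _ => ?_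
  rw [blockPair_comm blk hΔ]
  ring

end Literature.MathematicalPhysics.QuantumFieldTheory.BalabanImbrieJaffe1984to88.BIJ88DirichletDeriv305
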